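import Summits.HubbardSuperconductivity.HubbardSuperconductivity.Theses.ThermalWedge
import Literature.MathematicalPhysics.QuantumLattice.BdGBondHamiltonianTorus
import Literature.MathematicalPhysics.QuantumLattice.ApproximatingHamiltonianProofs
import Literature.MathematicalPhysics.QuantumLattice.DWaveSourceProofs
import Summits.HubbardSuperconductivity.HubbardSuperconductivity.Theorems.ThermalWedgeTwSourcedInertnessReduction

/-!
# Crux `TwSourcedCondensation` (item `stmt-HubbardSuperconductivity-1697`): a priori structure of
the sourced torus pressure — support lemmas from the standing disprover (generation 2)

The crux bounds the RESPONSE `p̃_L(h) - p̃_L(0)` of the torus pressure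
`p̃_L(β,U,μ,h) = log Re Z_β(dWaveSourceTorus L U μ h)/(βL²)` to the `d`-wave pair source
`-h(Δ_d + Δ_d†)` from below by `c h² log(1/(|h|+1/β)) - C h²`. This file proves, for EVERY
`L ≥ 1` and all `U, μ`, the exact structure of that response which every line of attack (and the
disproof workfile `Cruxes/TwSourcedCondensation/Disproof.lean`) uses:

* the constant gauge rotation `W = e^{iπN/2}` (`phaseGauge` by `e^{iπ/2}`) fixes `K₀ =
  hubbardTorusWith` and flips `Δ_g ↦ -Δ_g`, so `W H_{L,h} Wᴴ = H_{L,-h}`: the partition function is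
  EVEN in `h` and the source-free Gibbs state has NO anomalous average `⟨Δ_g + Δ_g†⟩ = ⟨Δ_g⟩ = 0`;
* POSITIVITY `log Z_β(H_{L,0}) ≤ log Z_β(H_{L,h})` (Peierls–Bogoliubov), i.e. the crux's RHS is `≥ 0`;
* the DEGENERATE `1 × 1` torus: `Δ_d = 0`, the response vanishes identically (so the crux's
  `∃ L₀` cannot be strengthened to `∀ L ≥ 1`, see the workfile).
(The Lipschitz bound `|p̃_L(h) - p̃_L(0)| ≤ 8√2|h|` is `abs_sourcedPressure_sub_le` of
`ThermalWedgeTwSourcedInertnessReduction`, reused, not re-proved.)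

Sources: T. Koma, H. Tasaki, PRL 68 (1992) 3248, eqs. (5)–(8) (gauge transformation);
Bratteli–Robinson II §5.3 (Peierls–Bogoliubov); F. J. Dyson, E. H. Lieb, B. Simon, J. Stat. Phys.
18 (1978) 335, §3 (Duhamel two-point function). Tree: `phaseGauge` API (`BdGBondHamiltonian`),
`pairField_dWaveFormFactor_eq` (`BdGBondHamiltonianTorus`), `norm_pairField_le`
(`DWaveSourceProofs`), `log_partitionFn_sub_le_log_partitionFn_add` (`ApproximatingHamiltonianProofs`),
`partitionFn_unitary_conj` (`DuhamelTwoPoint`), `norm_dWavePairSource_le`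
(`ThermalWedgeTwSourcedInertnessReduction`).
-/

noncomputable section

namespace Summit.HubbardSuperconductivity.HubbardSuperconductivity.Theorems.TwSourcedCondensation.Negative

open Matrix Finset Literature.MathematicalPhysics.QuantumLattice Literature.Probability.LatticeModels
open scoped Matrix.Norms.L2Operator ComplexOrder ComplexConjugate

/-! ### The constant gauge rotation by `e^{iπ/2}` -/

section Gauge

variable {Λ : Type*} [LinearOrder Λ] [Fintype Λ]

/-- `z · conj z = 1` on the unit circle. [folklore] -/
theorem circle_mul_conj (z : Circle) : (z : ℂ) * conj (z : ℂ) = 1 := by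
  rw [Complex.mul_conj, Circle.normSq_coe, Complex.ofReal_one]

/-- `conj(e^{iπ/2})² = e^{-iπ} = -1`. [folklore] -/
theorem conj_expHalfPi_mul_self :
    conj ((Circle.exp (Real.pi / 2) : Circle) : ℂ) * conj ((Circle.exp (Real.pi / 2) : Circle) : ℂ) =
      -1 := by
  rw [← map_mul, ← Circle.coe_mul, ← Circle.exp_add, add_halves, Circle.coe_exp,
    Complex.exp_pi_mul_I, map_neg, map_one]

/-- `W_gᴴ W_g = 1` for the site-phase transformation. [cite: KomaTasakiPRL1992, eq. (5)] -/
theorem conjTranspose_phaseGauge_mul_self (g : Λ → Circle) :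
    (phaseGauge g)ᴴ * phaseGauge g = 1 := by
  rw [phaseGauge, diagonal_conjTranspose, diagonal_mul_diagonal, ← diagonal_one]
  congr 1
  funext s
  rw [Pi.star_apply, Complex.star_def, mul_comm, circle_mul_conj]

/-- `W_g W_gᴴ = 1`. [cite: KomaTasakiPRL1992, eq. (5)] -/
theorem phaseGauge_mul_conjTranspose_self (g : Λ → Circle) :
    phaseGauge g * (phaseGauge g)ᴴ = 1 := by
  rw [phaseGauge, diagonal_conjTranspose, diagonal_mul_diagonal, ← diagonal_one]
  congr 1
  funext s
  rw [Pi.star_apply, Complex.star_def, circle_mul_conj]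

/-- A CONSTANT gauge rotation fixes every hopping monomial `c†_{xσ} c_{yτ}`. [cite: KomaTasakiPRL1992, eq. (7)] -/
theorem phaseGauge_const_conj_creation_mul_annihilation (g₀ : Circle) (x y : Λ) (σ τ : Fin 2) :
    phaseGauge (fun _ : Λ => g₀) * (creation (orb x σ) * annihilation (orb y τ)) *
        (phaseGauge (fun _ : Λ => g₀))ᴴ =
      creation (orb x σ) * annihilation (orb y τ) := by
  rw [phaseGauge_mul_mul_mul_conjTranspose, phaseGauge_mul_creation_mul_conjTranspose,
    phaseGauge_mul_annihilation_mul_conjTranspose, smul_mul_smul_comm, circle_mul_conj, one_smul]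

/-- A constant gauge rotation fixes the Hubbard Hamiltonian on any finite graph (particle-number
conservation in conjugation form). [cite: KomaTasakiPRL1992, eq. (7)] -/
theorem phaseGauge_const_conj_hamiltonian (G : SimpleGraph Λ) [DecidableRel G.Adj] (g₀ : Circle)
    (t U : ℝ) :
    phaseGauge (fun _ : Λ => g₀) * hamiltonian G t U * (phaseGauge (fun _ : Λ => g₀))ᴴ =
      hamiltonian G t U := by
  set W := phaseGauge (fun _ : Λ => g₀) with hW
  have hnum : ∀ x : Λ, W * (numberOp x 0 * numberOp x 1) * Wᴴ = numberOp x 0 * numberOp x 1 := by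
    intro x
    rw [hW, phaseGauge_mul_mul_mul_conjTranspose, phaseGauge_mul_numberOp_mul_conjTranspose,
      phaseGauge_mul_numberOp_mul_conjTranspose]
  have hhop : ∀ (x y : Λ) (σ : Fin 2),
      W * (if G.Adj x y then creation (orb x σ) * annihilation (orb y σ) else 0) * Wᴴ =
        (if G.Adj x y then creation (orb x σ) * annihilation (orb y σ) else 0) := by
    intro x y σ
    split_ifs
    · rw [hW, phaseGauge_const_conj_creation_mul_annihilation]
    · rw [Matrix.mul_zero, Matrix.zero_mul]
  unfold hamiltonian
  simp only [Matrix.mul_add, Matrix.add_mul, Matrix.mul_smul, Matrix.smul_mul, Finset.mul_sum,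
    Finset.sum_mul, hnum, hhop]

/-- A constant gauge rotation fixes the grand-canonical Hubbard Hamiltonian.
[cite: KomaTasakiPRL1992, eq. (7)] -/
theorem phaseGauge_const_conj_hamiltonianWith (G : SimpleGraph Λ) [DecidableRel G.Adj]
    (g₀ : Circle) (t U μ : ℝ) :
    phaseGauge (fun _ : Λ => g₀) * hamiltonianWith G t U μ * (phaseGauge (fun _ : Λ => g₀))ᴴ =
      hamiltonianWith G t U μ := by
  rw [hamiltonianWith_eq, Matrix.mul_sub, Matrix.sub_mul, phaseGauge_const_conj_hamiltonian,
    Matrix.mul_smul, Matrix.smul_mul, phaseGauge_mul_totalNumber_mul_conjTranspose]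

/-- The rotation by `e^{iπ/2}` flips the sign of every pair annihilator `c_{xσ} c_{yτ}`.
[cite: KomaTasakiPRL1992, eq. (8)] -/
theorem phaseGauge_halfPi_conj_annihilation_mul_annihilation (x y : Λ) (σ τ : Fin 2) :
    phaseGauge (fun _ : Λ => Circle.exp (Real.pi / 2)) * (annihilation (orb x σ) * annihilation (orb y τ)) *
        (phaseGauge (fun _ : Λ => Circle.exp (Real.pi / 2)))ᴴ =
      -(annihilation (orb x σ) * annihilation (orb y τ)) := by
  rw [phaseGauge_mul_mul_mul_conjTranspose, phaseGauge_mul_annihilation_mul_conjTranspose,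
    phaseGauge_mul_annihilation_mul_conjTranspose, smul_mul_smul_comm, conj_expHalfPi_mul_self,
    neg_smul, one_smul]

end Gauge

/-! ### The torus: `W H_{L,h} Wᴴ = H_{L,-h}`, evenness, no anomalous average, positivity -/

section Torus

variable (L : ℕ)

/-- `Wᴴ W = 1` on the torus (the `DecidableEq` instance found on `FermionTorus` differs
syntactically from the `LinearOrder`-derived one inside `phaseGauge`; `convert` bridges it). [folklore] -/
theorem conjTranspose_gaugeW_mul_self : (phaseGauge (fun _ : FermionTorus 2 L => Circle.exp (Real.pi / 2)))ᴴ * phaseGauge (fun _ : FermionTorus 2 L => Circle.exp (Real.pi / 2)) = 1 := by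
  have h := conjTranspose_phaseGauge_mul_self (Λ := FermionTorus 2 L) fun _ => Circle.exp (Real.pi / 2)
  convert h

/-- `W Wᴴ = 1` on the torus. [folklore] -/
theorem gaugeW_mul_conjTranspose_self : phaseGauge (fun _ : FermionTorus 2 L => Circle.exp (Real.pi / 2)) * (phaseGauge (fun _ : FermionTorus 2 L => Circle.exp (Real.pi / 2)))ᴴ = 1 := by
  have h := phaseGauge_mul_conjTranspose_self (Λ := FermionTorus 2 L) fun _ => Circle.exp (Real.pi / 2)
  convert h

/-- `W` is unitary. [folklore] -/
theorem gaugeW_mem_unitary :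
    phaseGauge (fun _ : FermionTorus 2 L => Circle.exp (Real.pi / 2)) ∈ unitary (Matrix (Finset (Orb (FermionTorus 2 L))) (Finset (Orb (FermionTorus 2 L))) ℂ) := by
  rw [Unitary.mem_iff, star_eq_conjTranspose]
  exact ⟨conjTranspose_gaugeW_mul_self L, gaugeW_mul_conjTranspose_self L⟩

/-- `W K₀ Wᴴ = K₀` for the grand-canonical torus Hubbard Hamiltonian. [cite: KomaTasakiPRL1992, eq. (7)] -/
theorem gaugeW_conj_hubbardTorusWith (t U μ : ℝ) :
    phaseGauge (fun _ : FermionTorus 2 L => Circle.exp (Real.pi / 2)) * hubbardTorusWith 2 L t U μ * (phaseGauge (fun _ : FermionTorus 2 L => Circle.exp (Real.pi / 2)))ᴴ = hubbardTorusWith 2 L t U μ := by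
  unfold hubbardTorusWith; exact phaseGauge_const_conj_hamiltonianWith _ _ t U μ

/-- `W` commutes with `K₀`. [folklore] -/
theorem gaugeW_mul_hubbardTorusWith (t U μ : ℝ) :
    phaseGauge (fun _ : FermionTorus 2 L => Circle.exp (Real.pi / 2)) * hubbardTorusWith 2 L t U μ = hubbardTorusWith 2 L t U μ * phaseGauge (fun _ : FermionTorus 2 L => Circle.exp (Real.pi / 2)) := by
  calc phaseGauge (fun _ : FermionTorus 2 L => Circle.exp (Real.pi / 2)) * hubbardTorusWith 2 L t U μ
      = phaseGauge (fun _ : FermionTorus 2 L => Circle.exp (Real.pi / 2)) * hubbardTorusWith 2 L t U μ * ((phaseGauge (fun _ : FermionTorus 2 L => Circle.exp (Real.pi / 2)))ᴴ * phaseGauge (fun _ : FermionTorus 2 L => Circle.exp (Real.pi / 2))) := by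
        rw [conjTranspose_gaugeW_mul_self, Matrix.mul_one]
    _ = phaseGauge (fun _ : FermionTorus 2 L => Circle.exp (Real.pi / 2)) * hubbardTorusWith 2 L t U μ * (phaseGauge (fun _ : FermionTorus 2 L => Circle.exp (Real.pi / 2)))ᴴ * phaseGauge (fun _ : FermionTorus 2 L => Circle.exp (Real.pi / 2)) := by rw [← Matrix.mul_assoc]
    _ = hubbardTorusWith 2 L t U μ * phaseGauge (fun _ : FermionTorus 2 L => Circle.exp (Real.pi / 2)) := by rw [gaugeW_conj_hubbardTorusWith]

variable [NeZero L]

/-- `W P_x Wᴴ = -P_x` for every local pair. [cite: KomaTasakiPRL1992, eq. (8)] -/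
theorem gaugeW_conj_localPair (g : Site 2 → ℝ) (x : TorusSite 2 L) :
    phaseGauge (fun _ : FermionTorus 2 L => Circle.exp (Real.pi / 2)) * localPair g L x * (phaseGauge (fun _ : FermionTorus 2 L => Circle.exp (Real.pi / 2)))ᴴ = -localPair g L x := by
  unfold localPair
  simp only [Finset.mul_sum, Finset.sum_mul, Matrix.mul_smul, Matrix.smul_mul, Matrix.mul_sub,
    Matrix.sub_mul, phaseGauge_halfPi_conj_annihilation_mul_annihilation, smul_neg, neg_sub_neg, smul_sub]
  rw [← Finset.sum_neg_distrib]
  refine Finset.sum_congr rfl fun e _ => ?_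
  abel

/-- **`W Δ_g Wᴴ = -Δ_g`** for the pair field of any form factor. [cite: KomaTasakiPRL1992, eq. (8)] -/
theorem gaugeW_conj_pairField (g : Site 2 → ℝ) :
    phaseGauge (fun _ : FermionTorus 2 L => Circle.exp (Real.pi / 2)) * pairField g L * (phaseGauge (fun _ : FermionTorus 2 L => Circle.exp (Real.pi / 2)))ᴴ = -pairField g L := by
  unfold pairField
  simp only [Finset.mul_sum, Finset.sum_mul, gaugeW_conj_localPair, Finset.sum_neg_distrib]

/-- `W Δ_gᴴ Wᴴ = -Δ_gᴴ`. [cite: KomaTasakiPRL1992, eq. (8)] -/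
theorem gaugeW_conj_pairField_conjTranspose (g : Site 2 → ℝ) :
    phaseGauge (fun _ : FermionTorus 2 L => Circle.exp (Real.pi / 2)) * (pairField g L)ᴴ * (phaseGauge (fun _ : FermionTorus 2 L => Circle.exp (Real.pi / 2)))ᴴ = -(pairField g L)ᴴ := by
  rw [phaseGauge_mul_conjTranspose_mul_conjTranspose, gaugeW_conj_pairField, conjTranspose_neg]

/-- **The gauge rotation reverses the source**: `W H_{L,h} Wᴴ = H_{L,-h}`. [cite: KomaTasakiPRL1992, eqs. (7)–(8)] -/
theorem gaugeW_conj_dWaveSourceTorus (U μ h : ℝ) :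
    phaseGauge (fun _ : FermionTorus 2 L => Circle.exp (Real.pi / 2)) * dWaveSourceTorus L U μ h * (phaseGauge (fun _ : FermionTorus 2 L => Circle.exp (Real.pi / 2)))ᴴ = dWaveSourceTorus L U μ (-h) := by
  rw [dWaveSourceTorus, dWaveSourceTorus, Matrix.mul_sub, Matrix.sub_mul, gaugeW_conj_hubbardTorusWith,
    Matrix.mul_smul, Matrix.smul_mul, Matrix.mul_add, Matrix.add_mul, gaugeW_conj_pairField,
    gaugeW_conj_pairField_conjTranspose, Complex.ofReal_neg]
  simp only [smul_add, smul_neg, neg_smul]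

/-- **Evenness of the sourced partition function**: `Z_β(H_{L,-h}) = Z_β(H_{L,h})`. [folklore] -/
theorem partitionFn_dWaveSourceTorus_neg (β U μ h : ℝ) :
    partitionFn β (dWaveSourceTorus L U μ (-h)) = partitionFn β (dWaveSourceTorus L U μ h) := by
  rw [← gaugeW_conj_dWaveSourceTorus, ← star_eq_conjTranspose,
    partitionFn_unitary_conj (gaugeW_mem_unitary L)]

/-- Invariance of a Gibbs state under a unitary commuting with the Hamiltonian
(Bratteli–Robinson II §5.3.1). [folklore] -/
theorem gibbsState_conj_of_commute {m : Type*} [Fintype m] [DecidableEq m] {H V : Matrix m m ℂ}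
    (hV : V * H = H * V) (hVV : Vᴴ * V = 1) (β : ℝ) (A : Matrix m m ℂ) :
    gibbsState β H (V * A * Vᴴ) = gibbsState β H A := by
  have hc : Commute (gibbsWeight β H) V := by
    have h1 : Commute (-(β : ℂ) • H) V := (Commute.smul_left (a := H) (b := V) hV.symm _)
    exact h1.exp_left
  rw [gibbsState_apply, gibbsState_apply]
  congr 1
  calc (gibbsWeight β H * (V * A * Vᴴ)).trace = (V * (gibbsWeight β H * A) * Vᴴ).trace := by
        rw [← Matrix.mul_assoc, ← Matrix.mul_assoc, hc.eq, Matrix.mul_assoc V]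
    _ = (Vᴴ * V * (gibbsWeight β H * A)).trace := by
        rw [trace_mul_cycle, Matrix.mul_assoc]
    _ = (gibbsWeight β H * A).trace := by rw [hVV, Matrix.one_mul]

/-- **No anomalous thermal average without source**: `⟨Δ_g + Δ_g†⟩_{β, K₀} = 0` for every `β`,
every form factor `g`, all `t, U, μ`, every `L` (`U(1)` symmetry). [cite: KomaTasakiPRL1992, eqs. (5)–(8)] -/
theorem gibbsState_hubbardTorusWith_pairSource (β t U μ : ℝ) (g : Site 2 → ℝ) :
    gibbsState β (hubbardTorusWith 2 L t U μ) (pairField g L + (pairField g L)ᴴ) = 0 := by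
  have h := gibbsState_conj_of_commute (gaugeW_mul_hubbardTorusWith L t U μ)
    (conjTranspose_gaugeW_mul_self L) β (pairField g L + (pairField g L)ᴴ)
  rw [Matrix.mul_add, Matrix.add_mul, gaugeW_conj_pairField, gaugeW_conj_pairField_conjTranspose,
    ← neg_add, map_neg, neg_eq_iff_add_eq_zero, add_self_eq_zero] at h
  exact h

/-- `⟨Δ_g⟩_{β,K₀} = 0` as well. [cite: KomaTasakiPRL1992, eqs. (5)–(8)] -/
theorem gibbsState_hubbardTorusWith_pairField (β t U μ : ℝ) (g : Site 2 → ℝ) :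
    gibbsState β (hubbardTorusWith 2 L t U μ) (pairField g L) = 0 := by
  have h := gibbsState_conj_of_commute (gaugeW_mul_hubbardTorusWith L t U μ)
    (conjTranspose_gaugeW_mul_self L) β (pairField g L)
  rw [gaugeW_conj_pairField, map_neg, neg_eq_iff_add_eq_zero, add_self_eq_zero] at h
  exact h

/-- **The source never lowers the torus pressure** (every real `β`, every `L ≥ 1`, all `U, μ, h`):
`log Z_β(H_{L,0}) ≤ log Z_β(H_{L,h})` — Peierls–Bogoliubov plus `⟨Δ_d + Δ_d†⟩_{K₀} = 0`. In
particular the right-hand side of `TwSourcedCondensation` is `≥ 0`. [folklore] -/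
theorem log_partitionFn_zero_le (β U μ h : ℝ) :
    Real.log (partitionFn β (dWaveSourceTorus L U μ 0)).re ≤
      Real.log (partitionFn β (dWaveSourceTorus L U μ h)).re := by
  have hK := isHermitian_hubbardTorusWith L 1 U μ
  have hQ := isHermitian_pairField_add_conjTranspose L
  have hW : (-(h : ℂ) • (pairField dWaveFormFactor L + (pairField dWaveFormFactor L)ᴴ)).IsHermitian := by
    refine IsHermitian.smul hQ ?_
    rw [isSelfAdjoint_iff, star_neg, Complex.star_def, Complex.conj_ofReal]
  have hPB := log_partitionFn_sub_le_log_partitionFn_add hK hW β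
  rw [map_smul, gibbsState_hubbardTorusWith_pairSource, smul_zero, Complex.zero_re, mul_zero,
    sub_zero] at hPB
  rw [dWaveSourceTorus_zero]
  convert hPB using 3
  rw [dWaveSourceTorus, sub_eq_add_neg, neg_smul]

/-- Quotient form: the response `p̃_L(h) - p̃_L(0)` of the crux is `≥ 0` for `β ≥ 0`. [folklore] -/
theorem pressure_response_nonneg {β : ℝ} (hβ : 0 ≤ β) (U μ h : ℝ) :
    0 ≤ Real.log (partitionFn β (dWaveSourceTorus L U μ h)).re / (β * (L : ℝ) ^ 2) -
      Real.log (partitionFn β (dWaveSourceTorus L U μ 0)).re / (β * (L : ℝ) ^ 2) := by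
  rw [← sub_div]
  exact div_nonneg (sub_nonneg.2 (log_partitionFn_zero_le L β U μ h)) (by positivity)

end Torus

/-! ### The degenerate `1 × 1` torus -/

section OneByOne

/-- On the `1 × 1` torus every directed bond is a loop: the two bond pairs of `Δ_d` coincide. [folklore] -/
theorem torusBondPair_one_eq (x : TorusSite 2 1) (i j : Fin 2) :
    torusBondPair 1 x i = torusBondPair 1 x j := by
  rw [torusBondPair_eq, torusBondPair_eq, Subsingleton.elim (x + Pi.single i 1) (x + Pi.single j 1)]

/-- **`Δ_d = 0` on the `1 × 1` torus** (`Δ_d = √2(Σ_x b_{x,0} - Σ_x b_{x,1})`, `b_{x,0} = b_{x,1}`). [folklore] -/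
theorem pairField_dWave_one : pairField dWaveFormFactor 1 = 0 := by
  rw [pairField_dWaveFormFactor_eq, Finset.sum_congr rfl fun x _ => torusBondPair_one_eq x 0 1,
    sub_self, smul_zero]

/-- Hence the sourced `1 × 1` Hamiltonian does not depend on the source, and the `L = 1` response
in `TwSourcedCondensation` vanishes identically. [folklore] -/
theorem dWaveSourceTorus_one (U μ h : ℝ) : dWaveSourceTorus 1 U μ h = dWaveSourceTorus 1 U μ 0 := by
  rw [dWaveSourceTorus, dWaveSourceTorus, pairField_dWave_one]
  simp

end OneByOne

end Summit.HubbardSuperconductivity.HubbardSuperconductivity.Theorems.TwSourcedCondensation.Negative
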